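import Mathlib
import Summits.ResolutionOfSingularities.ResolutionOfSingularities.Theorems.WeightedInvariantLocalWeightedDropWildPurePowerGeneric
import Summits.ResolutionOfSingularities.ResolutionOfSingularities.Theorems.WeightedInvariantLocalWeightedDropWildMonicFlagN0Transport

/-!
# `WeightedInvariant.LocalWeightedDrop`, line `hasse-ridge-face-selection`, S3ρ sub-stub S3ρD `stub_wildMonicSurfaceDescent`, case D-a:
# the scaled Newton set of the lift's POINT-STEP SUCCESSOR tuple is the chart image `Ψ_{d!}` of the position's (game bridge)

Crux item stmt-ResolutionOfSingularities-8899 `LocalWeightedDrop` (route `ResolutionOfSingularities/WeightedInvariant`), engine of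
the door `HypersurfaceCentreConstruction` stmt-ResolutionOfSingularities-19897.  [OURS · L1 W4.3, chain w43, res-L1-w43-stub-7 (second
seat on S3ρ under res-type-083; case D-a of `L/res-type-083/S3RHO-DESIGN.md` §1(D)).  Elementary; not a statement of any manuscript
[claim: Hironaka2017, status: under-review].]

For the successor tuple of `WildMonic.monic_won_of_descent` / `MonicPointBlowup.won_monic_of_pointBlowup` at an exceptional point `c`
of the point blow-up — `Tt_j = (s · Bv_j)|_{slice i₀}` with `A_j ∘ chart(c) = s^{d−j+1} · Bv_j` — stub-1's coefficient formula
`WildPurePower.coeff_pointStep_succ₀/₁` (the monomial `x₁^a x₂^b` of the sheared coefficient goes to `c_{i₀}^{…} · s^{a+b−(d−j)} x′^b`)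
gives, slot by slot with `q = d − j` and then scaled by `d!/(d−j)`:
* `newtonSet_pointStep₀` — slot `0`, any `c` with `c₁ ≠ 0`: `newtonSet Tt = Ψ_{d!}(newtonSet (A ∘ σ))`, `σ` the linear shear
  `x₂ ↦ x₂ + (c₂/c₁) x₁` (a free plane change of the game; at `t = c₂ = 0` it is the identity: `newtonSet_pointStep_axis₀`,
  `subst_shear_of_eq_zero`) — this is the hypothesis `N′ = psi d! '' N` of every law in `…WildMonicFlagN0Transport`;
* `newtonSet_pointStep₁` — slot `1` (`c₂ ≠ 0`): `newtonSet Tt = Ψ_{d!}(transpose of newtonSet (A ∘ σ′))` — in the successor's letters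
  the chart variable comes first, so the slot-`1` step is the slot-`0` step of the transposed data (`swapPt`);
* `factorial_le_of_mem_newtonSet` / `factorial_lt_of_mem_newtonSet` — `ord A_j ≥ d − j` (resp. a POSITION, `>`) puts the scaled
  Newton set on (resp. strictly above) the line `P₀ + P₁ = d!`: the standing hypothesis of the transport laws;
  `newtonSet_nonempty_of_ne_zero`, `newtonSet_eq_empty_iff`; `smul_psi`, `smul_swapPt` (scaling commutes with the chart maps).
-/

set_option linter.dupNamespace false -- mandated namespace of this single-conjunct summit

namespace Summit.ResolutionOfSingularities.ResolutionOfSingularities.Theorems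

namespace WildMonic

open MvPowerSeries MonicDescent Literature.AlgebraicGeometry.Resolution

variable {k : Type} [Field k]

/-! ## Scaling and the chart map -/

/-- Scaling commutes with the chart map: `N · Ψ_q(e) = Ψ_{Nq}(N · e)`. -/
theorem smul_psi (N q : ℕ) (e : Fin 2 →₀ ℕ) : N • psi q e = psi (N * q) (N • e) := by
  ext i
  fin_cases i
  · simp only [Fin.zero_eta, Finsupp.smul_apply, smul_eq_mul, psi_apply_zero]
    rw [Nat.mul_sub, Nat.mul_add]
  · simp only [Fin.mk_one, Finsupp.smul_apply, smul_eq_mul, psi_apply_one]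

/-- Evaluation of an explicit point at the letter `0`. -/
theorem pt_apply_zero (a b : ℕ) : (Finsupp.single (0 : Fin 2) a + Finsupp.single (1 : Fin 2) b : Fin 2 →₀ ℕ) 0 = a := by
  simp

/-- Evaluation of an explicit point at the letter `1`. -/
theorem pt_apply_one (a b : ℕ) : (Finsupp.single (0 : Fin 2) a + Finsupp.single (1 : Fin 2) b : Fin 2 →₀ ℕ) 1 = b := by
  simp

/-- The scaled Newton set of a tuple whose coefficients have `ord A_j ≥ d − j` lies on or above the line `P₀ + P₁ = d!`. -/
theorem factorial_le_of_mem_newtonSet {d : ℕ} {A : Fin d → MvPowerSeries (Fin 2) k}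
    (hA : ∀ j : Fin d, ((d - (j : ℕ) : ℕ) : ℕ∞) ≤ (A j).order) {P : Fin 2 →₀ ℕ} (hP : P ∈ newtonSet A) :
    d.factorial ≤ P 0 + P 1 := by
  obtain ⟨j, e, he, rfl⟩ := hP
  have hle := (hA j).trans (order_le he)
  have hdeg : e.degree = e 0 + e 1 := by simp [Finsupp.degree_eq_sum, Fin.sum_univ_two]
  rw [hdeg, Nat.cast_le] at hle
  simp only [Finsupp.smul_apply, smul_eq_mul]
  rw [← Nat.mul_add, ← slotWeight_mul_sub j]
  exact Nat.mul_le_mul_left _ hle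

/-- For a POSITION (`ord A_j > d − j`) the scaled Newton set lies strictly above the line `P₀ + P₁ = d!`. -/
theorem factorial_lt_of_mem_newtonSet {d : ℕ} {A : Fin d → MvPowerSeries (Fin 2) k}
    (hA : ∀ j : Fin d, ((d - (j : ℕ) : ℕ) : ℕ∞) < (A j).order) {P : Fin 2 →₀ ℕ} (hP : P ∈ newtonSet A) :
    d.factorial < P 0 + P 1 := by
  obtain ⟨j, e, he, rfl⟩ := hP
  have hlt := (hA j).trans_le (order_le he)
  have hdeg : e.degree = e 0 + e 1 := by simp [Finsupp.degree_eq_sum, Fin.sum_univ_two]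
  rw [hdeg, Nat.cast_lt] at hlt
  simp only [Finsupp.smul_apply, smul_eq_mul]
  rw [← Nat.mul_add, ← slotWeight_mul_sub j]
  exact Nat.mul_lt_mul_of_pos_left hlt (slotWeight_pos j)

/-- The scaled Newton set is nonempty as soon as one coefficient is nonzero. -/
theorem newtonSet_nonempty_of_ne_zero {d : ℕ} {A : Fin d → MvPowerSeries (Fin 2) k} {j : Fin d} (hj : A j ≠ 0) :
    (newtonSet A).Nonempty := by
  obtain ⟨e, he⟩ : ∃ e, coeff e (A j) ≠ 0 := by
    by_contra h
    exact hj (MvPowerSeries.ext fun e => by rw [map_zero]; exact not_not.mp fun hne => h ⟨e, hne⟩)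
  exact ⟨_, j, e, he, rfl⟩

/-- The scaled Newton set of the zero tuple is empty; conversely. -/
theorem newtonSet_eq_empty_iff {d : ℕ} (A : Fin d → MvPowerSeries (Fin 2) k) :
    newtonSet A = ∅ ↔ ∀ j, A j = 0 := by
  constructor
  · intro h j
    by_contra hj
    obtain ⟨P, hP⟩ := newtonSet_nonempty_of_ne_zero hj
    rw [h] at hP
    exact hP
  · intro h
    ext P
    simp only [Set.mem_empty_iff_false, iff_false]
    rintro ⟨j, e, he, -⟩
    exact he (by rw [h j, map_zero])

/-! ## The monomial point step in the `x₁`-chart, on the scaled Newton set -/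

/-- THE SCALED NEWTON SET OF THE POINT-STEP SUCCESSOR (slot `0`, exceptional point `c` with `c₁ ≠ 0`): for the lift's successor
tuple `Tt_j = (s · Bv_j)|_{slice 0}` (`A_j ∘ chart(c) = s^{d−j+1} Bv_j`, as in `WildMonic.monic_won_of_descent` /
`MonicPointBlowup.won_monic_of_pointBlowup`) one has `newtonSet Tt = Ψ_{d!}(newtonSet (A ∘ σ))`, where `σ` is the linear shear
`x₂ ↦ x₂ + (c₂/c₁) x₁` of stub-1's `WildPurePower.coeff_pointStep_succ₀` — provided every sheared coefficient has `ord ≥ d − j`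
(so that the chart division drops no monomial). -/
theorem newtonSet_pointStep₀ {d : ℕ} (c : Fin 2 → k) (hc : c 0 ≠ 0) (A : Fin d → MvPowerSeries (Fin 2) k)
    (Bv : Fin d → MvPowerSeries (Fin (2 + 1)) k)
    (hB : ∀ j : Fin d, subst (CobordantChart.chart (fun _ : Fin 2 => 1) c) (A j) = X 0 ^ (d - (j : ℕ) + 1) * Bv j)
    (hσ : ∀ j : Fin d, ((d - (j : ℕ) : ℕ) : ℕ∞) ≤
      (subst (fun l : Fin 2 => if l = 0 then (X 0 : MvPowerSeries (Fin 2) k) else X l + C (c 1 / c 0) * X 0) (A j)).order) :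
    newtonSet (fun j => TupleGame.slice (0 : Fin 2) (X 0 * Bv j)) =
      psi d.factorial '' newtonSet (fun j => subst (fun l : Fin 2 => if l = 0 then (X 0 : MvPowerSeries (Fin 2) k)
        else X l + C (c 1 / c 0) * X 0) (A j)) := by
  classical
  set Aσ : Fin d → MvPowerSeries (Fin 2) k := fun j => subst (fun l : Fin 2 => if l = 0 then (X 0 : MvPowerSeries (Fin 2) k)
    else X l + C (c 1 / c 0) * X 0) (A j) with hAσ
  ext P
  simp only [mem_newtonSet_iff, Set.mem_image]
  constructor
  · rintro ⟨j, β, hβ, rfl⟩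
    have hform := WildPurePower.coeff_pointStep_succ₀ (q := d - (j : ℕ)) c hc (A j) (Bv j) (hB j) β
    rw [hform] at hβ
    by_cases hle : β 1 ≤ β 0 + (d - (j : ℕ))
    · rw [if_pos hle] at hβ
      have he : coeff (Finsupp.single 0 (β 0 + (d - (j : ℕ)) - β 1) + Finsupp.single 1 (β 1)) (Aσ j) ≠ 0 :=
        right_ne_zero_of_mul hβ
      refine ⟨slotWeight d j • (Finsupp.single 0 (β 0 + (d - (j : ℕ)) - β 1) + Finsupp.single 1 (β 1)),
        ⟨j, _, he, rfl⟩, ?_⟩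
      rw [← slotWeight_mul_sub j, ← smul_psi]
      congr 1
      refine Literature.RingTheory.TwoVariableSeries.finsupp_fin2_ext ?_ ?_
      · rw [psi_apply_zero, pt_apply_zero, pt_apply_one]
        omega
      · rw [psi_apply_one, pt_apply_one]
    · rw [if_neg hle] at hβ
      exact absurd rfl hβ
  · rintro ⟨Q, ⟨j, e, he, rfl⟩, rfl⟩
    have hdeg : e.degree = e 0 + e 1 := by simp [Finsupp.degree_eq_sum, Fin.sum_univ_two]
    have hqe : d - (j : ℕ) ≤ e 0 + e 1 := by
      have h := (hσ j).trans (order_le he)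
      rwa [hdeg, Nat.cast_le] at h
    refine ⟨j, psi (d - (j : ℕ)) e, ?_, by rw [smul_psi, slotWeight_mul_sub]⟩
    rw [WildPurePower.coeff_pointStep_succ₀ (q := d - (j : ℕ)) c hc (A j) (Bv j) (hB j), psi_apply_zero, psi_apply_one,
      if_pos (by omega)]
    refine mul_ne_zero (pow_ne_zero _ hc) ?_
    have hee : Finsupp.single 0 (e 0 + e 1 - (d - (j : ℕ)) + (d - (j : ℕ)) - e 1) + Finsupp.single 1 (e 1) = e :=
      Literature.RingTheory.TwoVariableSeries.finsupp_fin2_ext (by rw [pt_apply_zero]; omega) (by rw [pt_apply_one])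
    rw [hee]
    exact he

/-- The shear of `coeff_pointStep_succ₀` at an AXIS point (`c₂ = 0`) is the identity. -/
theorem subst_shear_of_eq_zero (c : Fin 2 → k) (hc1 : c 1 = 0) (A : MvPowerSeries (Fin 2) k) :
    subst (fun l : Fin 2 => if l = 0 then (X 0 : MvPowerSeries (Fin 2) k) else X l + C (c 1 / c 0) * X 0) A = A := by
  have h : (fun l : Fin 2 => if l = 0 then (X 0 : MvPowerSeries (Fin 2) k) else X l + C (c 1 / c 0) * X 0) =
      (X : Fin 2 → MvPowerSeries (Fin 2) k) := by
    funext l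
    split_ifs with hl
    · rw [hl]
    · rw [hc1, zero_div, map_zero, zero_mul, add_zero]
  rw [h, subst_self]
  rfl

/-- THE MONOMIAL POINT STEP (slot `0`, exceptional point ON THE AXIS, `c = (c₁, 0)`, `c₁ ≠ 0`; Perlega's / HP's `t = 0`): the scaled
Newton set of the successor position is EXACTLY `Ψ_{d!}` of that of the position — the hypothesis of every transport law of
`…WildMonicFlagN0Transport` (`N′ = psi d! '' N`). -/
theorem newtonSet_pointStep_axis₀ {d : ℕ} (c : Fin 2 → k) (hc : c 0 ≠ 0) (hc1 : c 1 = 0) (A : Fin d → MvPowerSeries (Fin 2) k)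
    (hA : ∀ j : Fin d, ((d - (j : ℕ) : ℕ) : ℕ∞) ≤ (A j).order) (Bv : Fin d → MvPowerSeries (Fin (2 + 1)) k)
    (hB : ∀ j : Fin d, subst (CobordantChart.chart (fun _ : Fin 2 => 1) c) (A j) = X 0 ^ (d - (j : ℕ) + 1) * Bv j) :
    newtonSet (fun j => TupleGame.slice (0 : Fin 2) (X 0 * Bv j)) = psi d.factorial '' newtonSet A := by
  have h := newtonSet_pointStep₀ c hc A Bv hB (fun j => by rw [subst_shear_of_eq_zero c hc1]; exact hA j)
  simp only [subst_shear_of_eq_zero c hc1] at h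
  exact h

/-! ## The monomial point step in the `x₂`-chart: the successor is the `x₁`-chart successor of the TRANSPOSED tuple -/

/-- Transposition commutes with scaling. -/
theorem smul_swapPt (N : ℕ) (P : Fin 2 →₀ ℕ) :
    N • Finsupp.equivMapDomain (Equiv.swap (0 : Fin 2) 1) P = Finsupp.equivMapDomain (Equiv.swap (0 : Fin 2) 1) (N • P) :=
  Literature.RingTheory.TwoVariableSeries.finsupp_fin2_ext
    (by rw [Finsupp.smul_apply, swapPt_apply_zero, swapPt_apply_zero, Finsupp.smul_apply])
    (by rw [Finsupp.smul_apply, swapPt_apply_one, swapPt_apply_one, Finsupp.smul_apply])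

/-- THE SCALED NEWTON SET OF THE POINT-STEP SUCCESSOR IN SLOT `1` (exceptional point `c` with `c₂ ≠ 0`): `newtonSet Tt =
Ψ_{d!}(transpose of newtonSet (A ∘ σ′))`, `σ′` the shear `x₁ ↦ x₁ + (c₁/c₂) x₂` of `WildPurePower.coeff_pointStep_succ₁` — in the
successor's letters (`s`, `x₁′`) the chart variable comes first, so the slot-`1` step is the slot-`0` step of the transposed data. -/
theorem newtonSet_pointStep₁ {d : ℕ} (c : Fin 2 → k) (hc : c 1 ≠ 0) (A : Fin d → MvPowerSeries (Fin 2) k)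
    (Bv : Fin d → MvPowerSeries (Fin (2 + 1)) k)
    (hB : ∀ j : Fin d, subst (CobordantChart.chart (fun _ : Fin 2 => 1) c) (A j) = X 0 ^ (d - (j : ℕ) + 1) * Bv j)
    (hσ : ∀ j : Fin d, ((d - (j : ℕ) : ℕ) : ℕ∞) ≤
      (subst (fun l : Fin 2 => if l = 1 then (X 1 : MvPowerSeries (Fin 2) k) else X l + C (c 0 / c 1) * X 1) (A j)).order) :
    newtonSet (fun j => TupleGame.slice (1 : Fin 2) (X 0 * Bv j)) =
      psi d.factorial '' (Finsupp.equivMapDomain (Equiv.swap (0 : Fin 2) 1) '' newtonSet (fun j => subst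
        (fun l : Fin 2 => if l = 1 then (X 1 : MvPowerSeries (Fin 2) k) else X l + C (c 0 / c 1) * X 1) (A j))) := by
  classical
  set Aσ : Fin d → MvPowerSeries (Fin 2) k := fun j => subst (fun l : Fin 2 => if l = 1 then (X 1 : MvPowerSeries (Fin 2) k)
    else X l + C (c 0 / c 1) * X 1) (A j) with hAσ
  ext P
  simp only [mem_newtonSet_iff, Set.mem_image, exists_exists_and_eq_and]
  constructor
  · rintro ⟨j, β, hβ, rfl⟩
    have hform := WildPurePower.coeff_pointStep_succ₁ (q := d - (j : ℕ)) c hc (A j) (Bv j) (hB j) β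
    rw [hform] at hβ
    by_cases hle : β 1 ≤ β 0 + (d - (j : ℕ))
    · rw [if_pos hle] at hβ
      have he : coeff (Finsupp.single 0 (β 1) + Finsupp.single 1 (β 0 + (d - (j : ℕ)) - β 1)) (Aσ j) ≠ 0 :=
        right_ne_zero_of_mul hβ
      refine ⟨slotWeight d j • (Finsupp.single 0 (β 1) + Finsupp.single 1 (β 0 + (d - (j : ℕ)) - β 1)),
        ⟨j, _, he, rfl⟩, ?_⟩
      rw [← smul_swapPt, ← slotWeight_mul_sub j, ← smul_psi]
      congr 1
      refine Literature.RingTheory.TwoVariableSeries.finsupp_fin2_ext ?_ ?_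
      · rw [psi_apply_zero, swapPt_apply_zero, swapPt_apply_one, pt_apply_zero, pt_apply_one]
        omega
      · rw [psi_apply_one, swapPt_apply_one, pt_apply_zero]
    · rw [if_neg hle] at hβ
      exact absurd rfl hβ
  · rintro ⟨Q, ⟨j, e, he, rfl⟩, rfl⟩
    have hdeg : e.degree = e 0 + e 1 := by simp [Finsupp.degree_eq_sum, Fin.sum_univ_two]
    have hqe : d - (j : ℕ) ≤ e 0 + e 1 := by
      have h := (hσ j).trans (order_le he)
      rwa [hdeg, Nat.cast_le] at h
    refine ⟨j, psi (d - (j : ℕ)) (Finsupp.equivMapDomain (Equiv.swap (0 : Fin 2) 1) e), ?_,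
      by rw [smul_psi, slotWeight_mul_sub, smul_swapPt]⟩
    rw [WildPurePower.coeff_pointStep_succ₁ (q := d - (j : ℕ)) c hc (A j) (Bv j) (hB j), psi_apply_zero, psi_apply_one,
      swapPt_apply_zero, swapPt_apply_one, if_pos (by omega)]
    refine mul_ne_zero (pow_ne_zero _ hc) ?_
    have hee : Finsupp.single 0 (e 0) + Finsupp.single 1 (e 1 + e 0 - (d - (j : ℕ)) + (d - (j : ℕ)) - e 0) = e :=
      Literature.RingTheory.TwoVariableSeries.finsupp_fin2_ext (by rw [pt_apply_zero]) (by rw [pt_apply_one]; omega)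
    rw [hee]
    exact he

end WildMonic

end Summit.ResolutionOfSingularities.ResolutionOfSingularities.Theorems
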